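import Summits.ResolutionOfSingularities.KangarooAtlas.MizutaniLevelComparison
import Summits.ResolutionOfSingularities.KangarooAtlas.MizutaniTowerCoeff
import Summits.ResolutionOfSingularities.KangarooAtlas.MizutaniDigitSplit
import Summits.ResolutionOfSingularities.KangarooAtlas.MizutaniOperatorOrder
import HarnessLib

/-!
# Mizutani's Lemma 2.4 (dual pair form) and the point half of Lemma 2.7 for fields with a finite `p`-basis

Cell `pub-rosobs`, Mizutani enclosure (seat mizutani-encloser-1, gen 9).  AI-written; *AI review is weaker than
expert review*; NOT a resolution-of-singularities theorem (summit relevance C).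

`MizutaniLevelComparison.lean` reduced the inclusion `𝒥_e𝒟_e(V) ⊆ 𝒥_{e+1}𝒟_{e+1}(V)` (Mizutani 1973, proof of Lemma 2.7) to
Lemma 2.4 in the dual pair form «if `Σ_i D'(a_i)·D₀(c_i) = 0` for all `D' ∈ Diff_{p^e−1}(k/k^{p^e})`,
`D₀ ∈ Diff_{p^{e+1}−p^e}(k/k^{p^{e+1}})`, then `Σ a_i ⊗ c_i ∈ J_{e+1}^{p^{e+1}}`».  This file PROVES that statement for every field `k`
which is a ROOT TOWER over `k^{p^{e+1}}` (order `p^{e+1}`) and over `k^{p^e}` (order `p^e`) with the same generators `b` — e.g. a field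
of finite `p`-degree with a finite `p`-basis `b` (`towerField (e+1) b = k`; Mizutani's own setting `K = k^q(c_1,…,c_m)` p. 88) —:

* `mchoose_cast_ne_zero_of_digitLE` — Lucas: `T ≤_p N` digitwise in every coordinate ⇒ `C(N,T) ≢ 0` in `k`;
* **`lemma24_pair_of_isRootTower`** — with `D₀ := D^{(M)}` (`|M| ≤ p^{e+1} − p^e`, `isDiffOpLE_hsD`) the hypothesis gives
  `Σ a_i ⊗ D^{(M)}c_i ∈ J_e^{p^e}` (`forall_sum_apply_mul_eq_zero_iff`), whose `Ω_e`-coefficients of degree `≤ p^e − 1` vanish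
  (`degree_le_of_mem_pow`, `coeff_Omega_tens`): `Σ_i a_i D^{(T)}D^{(M)} c_i = 0`; by `hsD_eq_of_towers`, `hsD_comm`, `hsD_hsD` this is
  `C(N,T)·Σ_i a_i D^{(N)} c_i = 0` for `N = T + M`; the digit split (`exists_digit_split'`) provides such `T, M` for every `N` with
  `|N| ≤ p^{e+1} − 1` with `C(N,T) ≢ 0`, so every low coefficient of `Ω_{e+1}(Σ a_i ⊗ c_i)` vanishes and
  `mem_pow_of_forall_coeff_Omega` concludes;
* **`jCore_dSpan_le_succ_of_isRootTower`** (`𝒥_e𝒟_e V ≤ 𝒥_{e+1}𝒟_{e+1} V`) and **`exists_isPoint_invForms_eq_pred_of_isRootTower`** —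
  THE POINT HALF OF LEMMA 2.7 (one Frobenius step) for such `k`: the level-`(e+1)` invariant forms of a point of exponent `≤ e+1` are
  the level-`e` invariant forms of a point of exponent `≤ e` (the point of `F(B_{P,𝔭})`, encloser-2's `comap_expand_bIdeal`).

NOT covered: arbitrary `k` (infinite `p`-degree) — the operators `D^{(M)}` of a finite `p`-independent envelope do not extend to `k`
without a `p`-basis; see the seat HANDOFF.

References: H. Mizutani, Nagoya Math. J. 52 (1973), Lemma 2.4, Lemma 2.7 [Mizutani1973HironakaGroupSchemes]; T. Oda, Publ. RIMS 19
(1983), §1 [Oda1983HironakaGroupSchemeII]; EGA IV 16.11.2 [EGAIV4].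
-/

noncomputable section

open MvPolynomial TensorProduct Literature.AlgebraicGeometry.Resolution
  Literature.AlgebraicGeometry.Resolution.HironakaScheme

namespace Summit.ResolutionOfSingularities.KangarooAtlas.Mizutani

universe u

section Lemma24

variable (k : Type u) [Field k] (p : ℕ) [hp : Fact p.Prime] [CharP k p] {n s : ℕ} (e : ℕ)
  {b : Fin s → k} {x₁ : Fin s → frobPow k p (e + 1)} {x₀ : Fin s → frobPow k p e}

/-- **Lucas**: if `T_i ≤_p N_i` digitwise for every `i` then `C(N,T) = ∏ C(N_i,T_i)` is nonzero in `k`. [folklore] -/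
theorem mchoose_cast_ne_zero_of_digitLE {N T : Fin s →₀ ℕ} (h : ∀ i, DigitLemma.DigitLE p (T i) (N i)) :
    (mchoose N T : k) ≠ 0 := by
  rw [mchoose_eq_prod, Nat.cast_prod]
  refine Finset.prod_ne_zero_iff.mpr fun i _ => ?_
  rw [Ne, CharP.cast_eq_zero_iff k p]
  exact (DigitLemma.digitLE_iff_not_dvd_choose (T i) (N i)).mp (h i)

/-- **MIZUTANI'S LEMMA 2.4 (dual pair form) for a field which is a root tower over `k^{p^{e+1}}` and `k^{p^e}` with the same
generators**: if `Σ_i D'(a_i)·D₀(c_i) = 0` for all `D' ∈ Diff_{p^e−1}(k/k^{p^e})` and all `D₀ ∈ Diff_{p^{e+1}−p^e}(k/k^{p^{e+1}})`, then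
`Σ a_i ⊗ c_i ∈ J_{e+1}^{p^{e+1}}`.  AI-written; *AI review is weaker than expert review*.
[cite: Mizutani1973HironakaGroupSchemes, Lemma 2.4 (Diff_{q−1}(k)V = Diff_{q−q'}(k)·Diff_{q'−1}(k)V)] -/
theorem lemma24_pair_of_isRootTower (h₁ : IsRootTower (frobPow k p (e + 1)) k (p ^ (e + 1)) x₁ b)
    (h₀ : IsRootTower (frobPow k p e) k (p ^ e) x₀ b) (a c : Fin (n + 1) → k)
    (hac : ∀ (D' : k →ₗ[frobPow k p e] k) (D₀ : k →ₗ[frobPow k p (e + 1)] k), IsDiffOpLE (frobPow k p e) (p ^ e - 1) D' →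
      IsDiffOpLE (frobPow k p (e + 1)) (p ^ (e + 1) - p ^ e) D₀ → ∑ i, D' (a i) * D₀ (c i) = 0) :
    tens k p (e + 1) a c ∈ KaehlerDifferential.ideal (frobPow k p (e + 1)) k ^ p ^ (e + 1) := by
  classical
  have hp2 : 2 ≤ p := hp.out.two_le
  have hqpos : 0 < p ^ e := pow_pos hp.out.pos e
  refine h₁.mem_pow_of_forall_coeff_Omega fun N hN => ?_
  by_contra hlt
  push Not at hlt
  have hNbox : InBox (p ^ (e + 1)) N := h₁.Omega_box _ N hN
  -- the digit split `N = T' + M'`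
  have hNsum : ∑ i, N i + 1 ≤ p * p ^ e := by
    rw [← Finsupp.degree_eq_sum, ← pow_succ']; exact hlt
  obtain ⟨T, hdig, hTN, hTlt, hTsum, hMsum⟩ := DigitLemma.exists_digit_split' hp2 e (fun i => N i) hNsum
  set T' : Fin s →₀ ℕ := Finsupp.equivFunOnFinite.symm T with hT'
  have hT'i : ∀ i, T' i = T i := fun i => by rw [hT', Finsupp.coe_equivFunOnFinite_symm]
  have hT'le : T' ≤ N := fun i => by rw [hT'i]; exact hTN i
  set M' : Fin s →₀ ℕ := N - T' with hM'
  have hTM : M' + T' = N := tsub_add_cancel_of_le hT'le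
  have hT'box : InBox (p ^ e) T' := fun i => by rw [hT'i]; exact hTlt i
  have hM'box : InBox (p ^ (e + 1)) M' := fun i => by
    rw [hM', Finsupp.tsub_apply]; exact lt_of_le_of_lt (Nat.sub_le _ _) (hNbox i)
  have hM'deg : M'.degree ≤ p ^ (e + 1) - p ^ e := by
    rw [Finsupp.degree_eq_sum]
    have : ∑ i, M' i = ∑ i, (N i - T i) := Finset.sum_congr rfl fun i _ => by rw [hM', Finsupp.tsub_apply, hT'i]
    rw [this, pow_succ']
    omega
  -- instantiate the hypothesis with `D₀ = D^{(M')}`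
  set d : Fin (n + 1) → k := fun i => h₁.hsD M' (c i) with hd
  have hD₀ : IsDiffOpLE (frobPow k p (e + 1)) (p ^ (e + 1) - p ^ e) (h₁.hsD M') := h₁.isDiffOpLE_hsD _ hM'box hM'deg
  have htens : tens k p e a d ∈ KaehlerDifferential.ideal (frobPow k p e) k ^ p ^ e :=
    (forall_sum_apply_mul_eq_zero_iff k p e a d).mp fun D' hD' => hac D' _ hD' hD₀
  -- the `T'`-coefficient of `Ω_e` vanishes (`|T'| ≤ p^e − 1`)
  have hcoef : ∑ i, a i * h₀.hsD T' (d i) = 0 := by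
    rw [← coeff_Omega_tens k p e h₀ a d T']
    by_contra hne
    have hdegT := h₀.degree_le_of_mem_pow htens T' (mem_support_iff.mpr hne)
    rw [Finsupp.degree_eq_sum] at hdegT
    have : ∑ i, T' i = ∑ i, T i := Finset.sum_congr rfl fun i _ => hT'i i
    omega
  -- `D₀^{(T')} D₁^{(M')} = D₁^{(M')} D₁^{(T')} = C(N,T') D₁^{(N)}`
  have hcomp : ∀ i, h₀.hsD T' (d i) = (mchoose N T' : k) * h₁.hsD N (c i) := by
    intro i
    rw [hd, ← hsD_eq_of_towers k p e h₁ h₀ hT'box, h₁.hsD_comm, h₁.hsD_hsD, hTM]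
  simp_rw [hcomp] at hcoef
  have hsum : (mchoose N T' : k) * ∑ i, a i * h₁.hsD N (c i) = 0 := by
    rw [Finset.mul_sum, ← hcoef]
    exact Finset.sum_congr rfl fun i _ => by ring
  have hC : (mchoose N T' : k) ≠ 0 := mchoose_cast_ne_zero_of_digitLE k p fun i => by rw [hT'i]; exact hdig i
  have hzero : ∑ i, a i * h₁.hsD N (c i) = 0 := (mul_eq_zero.mp hsum).resolve_left hC
  rw [← coeff_Omega_tens k p (e + 1) h₁ a c N] at hzero
  exact (mem_support_iff.mp hN) hzero

/-- **`𝒥_e𝒟_e(V) ⊆ 𝒥_{e+1}𝒟_{e+1}(V)`** for such `k` (Mizutani's «`𝒥_{e'}𝒟_{e'}(V) ⊂ 𝒥_e𝒟_e(V)`», one step).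
[cite: Mizutani1973HironakaGroupSchemes, Lemma 2.7 (proof)] -/
theorem jCore_dSpan_le_succ_of_isRootTower (h₁ : IsRootTower (frobPow k p (e + 1)) k (p ^ (e + 1)) x₁ b)
    (h₀ : IsRootTower (frobPow k p e) k (p ^ e) x₀ b) (V : Submodule k (Fin (n + 1) → k)) :
    jCore k p e (dSpan k p e V) ≤ jCore k p (e + 1) (dSpan k p (e + 1) V) :=
  jCore_dSpan_le_succ_of_lemma24 k p e (fun a c hac => lemma24_pair_of_isRootTower k p e h₁ h₀ a c hac) V

/-- **THE POINT HALF OF LEMMA 2.7 (one Frobenius step) for such `k`**: if `V` is `(L_B)_{e+1}(𝔭)` of a point `𝔭` of `ℙ^n_k` with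
exponent `≤ e + 1`, then `V` is `(L_B)_e(𝔮)` of a point `𝔮` with exponent `≤ e` — the point whose Hironaka scheme is the
Frobenius image `F(B_{P,𝔭})`.  AI-written; *AI review is weaker than expert review*; not a resolution theorem.
[cite: Mizutani1973HironakaGroupSchemes, Lemma 2.7] -/
theorem exists_isPoint_invForms_eq_pred_of_isRootTower (h₁ : IsRootTower (frobPow k p (e + 1)) k (p ^ (e + 1)) x₁ b)
    (h₀ : IsRootTower (frobPow k p e) k (p ^ e) x₀ b) {V : Submodule k (Fin (n + 1) → k)}
    (hV : ∃ 𝔭 : Ideal (MvPolynomial (Fin (n + 1)) k), IsPoint k 𝔭 ∧ ExponentLE k p 𝔭 (e + 1) ∧ invForms k p 𝔭 (e + 1) = V) :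
    ∃ 𝔮 : Ideal (MvPolynomial (Fin (n + 1)) k), IsPoint k 𝔮 ∧ ExponentLE k p 𝔮 e ∧ invForms k p 𝔮 e = V :=
  exists_isPoint_invForms_eq_pred_of_lemma24 k p e (fun a c hac => lemma24_pair_of_isRootTower k p e h₁ h₀ a c hac) hV

end Lemma24

end Summit.ResolutionOfSingularities.KangarooAtlas.Mizutani

end
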